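import Literature.NumberTheory.Automorphic.ArchInnerFormChartOrbPlaces        -- ★ G3 (LH3-p03 (g3)): `chartBoxImgG_eq_setOf_forall_mem_chartBoxImgGLoc`; brings ★ G1∕G2 (`chartTorusGLoc`, `chartBoxImgGLoc`, `chartOrbG_eq_of_isHaarMeasure`) and ★ `InvariantQuotientPiFactor`
import Literature.NumberTheory.Rogawski1990.ArchInnerFormChartOrbIntegrable    -- ★ D4b-3 (F0P3a-p08 (g22)): `integrable_descConj_gprimeTorus_of_regG` (the `Integrable` binder at `c ∈ RegG S′`)
import HarnessLib

/-!
# `chartOrbG` as ONE integral over the product of the LOCAL quotients, split into the split-chart places `w ∈ S′` and the compact-chart places `w ∉ S′`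
# («(A1) SPLIT∕COMPACT PRODUCT FORM» of the E3 §4 assembly — Folland 1995 §2.6 (2.52); Gelbart 1975 (10.19); Rogawski 1990 §8.2–8.3; Borel–Jacquet 1979 §4.1)

Topic `NumberTheory/Rogawski1990`; namespace `Literature.NumberTheory.Automorphic.UnitaryGroup`.  THEOREMS ONLY (no `def`, no instance, no notation, no axiom, no named fact,
no `sorry`).  Cell `pub/hodgecm-mathlib`, crux H413 (`stmt-HodgeConjecture-24833`), F0∕P3c line LH3 (closer stub `stub_N9`, DIRECT ROAD `F0_P3c_StubN9Direct`), LETTER L1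
`HcOrbitalFamiliesStatement`, clause (I₂): brick **(A1)** of F0P3b-p01 (g16)'s `SPEC-E3-assembly.v1.md` («GLOBAL PARABOLIC DESCENT AT THE SPLIT PLACES», LH3-plan (g3) RULING #13,
2026-09-02), seat LH3-p02 (g4).  Count-neutral measure-theoretic bookkeeping.

THE MATHEMATICS.  `G′_∞ = U(diag α)(L⁺ ⊗ ℝ) ≃ₜ* Π_w U(α)_w` (`e = archPiEquivCM 3 L (diagonal α)`); for an ADMISSIBLE label `S′` (`hα : ∀ i, α i ≠ 0`, `S′ ⊆ splitChartPlaces`) the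
chart torus is placewise, `T_{S′} ↔ Π_w T′_{S′,w}` (★ `mem_chartTorusG_iff_forall_mem_chartTorusGLoc`), so ★ `exists_haar_homeomorph_map_quotientMeasure_pi` gives
`Ψ : G′_∞ ⧸ T_{S′} ≃ₜ Π_w (U(α)_w ⧸ T′_{S′,w})` with `Ψ_* (ν′ ∕ ρ) = ⊗_w (ν′_w ∕ t_w)` (product Haar `ν′ = e⁻¹_* ⊗_w ν′_w`, ANY Haar family `t_w` on the local tori).  Hence, for EVERY
test function `a′` (no tensor structure — a MEASURE identity) and EVERY coordinate `c` (no regularity, no integrability), `γ_w(c) = gprimeBlockAt α w S′ (c w)`: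
* §1 **`chartOrbG_eq_prod_mul_integral_pi`**: `chartOrbG ν′ S′ a′ c = (Π_w t_w(B′_w)) · ∫_{Π_w (U(α)_w ⧸ T′_w)} a′ (e⁻¹ (x_w γ_w(c) x_w⁻¹)_w) d(⊗_w (ν′_w ∕ t_w))` (★ G3
  `chartOrbG_eq_prod_chartOrbGLoc` is the tensor case);
* §2 **`chartOrbG_eq_prod_mul_integral_prod_pi`**: the index split `W = {w ∈ S′} ⊔ {w ∉ S′}` (Mathlib `MeasurableEquiv.piEquivPiSubtypeProd`; §0 = its
  measure-preservation with the subtype `Fintype` instances as binders), hypothesis-free;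
* §3 **`chartOrbG_eq_prod_mul_integral_pi_prod_quotient`** — THE MIXED FORM OF RECORD (E3 §4 assembly): split half `⊗_{w∈S′} (U_w ⧸ T′_w)` in `descConj (γ_w(c)) T′_w _ id` currency
  (what (A2) transports to `U(J₃)(ℂ) ⧸ torusU` and (A3) unfolds to `K_w × N_w`), compact half ONE quotient `(Π_{w∉S′} U_w) ⧸ (Π_{w∉S′} T′_w)` in `descConj (γ_cpt(c)) M_cpt _` currency against
  its Weil quotient measure (★ `quotientPiHomeomorph`, ★ `map_quotientPiHomeomorph_quotientMeasure_pi`) — literally the integrand shape of ★ (HYP-PARAM)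
  `contDiffOn_integral_descConj_of_uniformlyProper_param` with `G := Π_{w∉S′} U(α)_w`, `M := Subgroup.pi univ T′` ((A4)∕(A5)); hypothesis-free; the Haar `ρ_cpt` on `M_cpt` with
  coordinates `⊗ t_w` exists (§0 `exists_haar_map_subgroupPiCoords_eq_pi`);
* §4 **`chartOrbG_eq_prod_mul_integral_integral`** — the ITERATED form (compact places OUTSIDE, split places INSIDE; Fubini, needs the `Integrable` binder, **discharged at every
  `c ∈ RegG S′` for `a′ ∈ C_c(G′_∞)`** by ★ D4b-3: `…_of_regG`).
HONEST LABEL: HC_CM is proved only modulo the 7 printed citations (2 remaining: hLiu418 = `stmt-HodgeConjecture-24832`, h413 = `stmt-HodgeConjecture-24833`) until rung 0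
closes; this file moves no row of the books (letter-L1 pay-down plumbing).

## References
* [Folland1995] G. B. Folland, *A Course in Abstract Harmonic Analysis* (1995), §2.2, §2.6 Thm. 2.49, (2.52).
* [Gelbart1975] S. Gelbart, *Automorphic forms on adele groups*, Ann. of Math. Studies 83 (1975), §10, p. 155, (10.19).
* [Rogawski1990] J. D. Rogawski, *Automorphic Representations of Unitary Groups in Three Variables*, Ann. of Math. Stud. 123 (1990), §3.6 p. 31, §8.2 p. 122, §8.3 p. 124.
* [BorelJacquet1979] A. Borel, H. Jacquet, *Automorphic forms and automorphic representations*, PSPM 33.1 (1979), §4.1 (`G_∞ = Π_v G(F_v)`, product measures).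
* [DeitmarEchterhoff2014] A. Deitmar, S. Echterhoff, *Principles of Harmonic Analysis*, 2nd ed. (2014), Thm. 1.5.3, Lemma 9.3.3.
-/

set_option autoImplicit false

noncomputable section

open MeasureTheory MeasureTheory.Measure NumberField NumberField.InfinitePlace Matrix Complex Topology
open Literature.MeasureTheory.Group Literature.NumberTheory.Rogawski1990
open scoped MatrixGroups Matrix Classical ENNReal NNReal

namespace Literature.MeasureTheory.Group

/-! ## §0 (generic) Splitting the index set of a finite product measure -/

/-- Mathlib's `measurePreserving_piEquivPiSubtypeProd` with the `Fintype` instances of the two index subtypes `{i // p i}`, `{i // ¬ p i}` taken as BINDERS (so that it applies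
verbatim when `p = (· ∈ S)` for a `Finset S`, whose subtype carries the instance `Finset.Subtype.fintype` rather than `Subtype.fintype`): the coordinate split
`(Π_i α_i) ≃ᵐ (Π_{p i} α_i) × (Π_{¬ p i} α_i)` carries `⊗_i μ_i` to `(⊗_{p i} μ_i) ⊗ (⊗_{¬ p i} μ_i)`. [cite: Folland1995, §2.2] -/
theorem measurePreserving_piEquivPiSubtypeProd' {ι : Type*} [Fintype ι] {α : ι → Type*} [∀ i, MeasurableSpace (α i)]
    (μ : ∀ i, Measure (α i)) [∀ i, SigmaFinite (μ i)] (p : ι → Prop) [DecidablePred p] [Fintype {i // p i}] [Fintype {i // ¬ p i}] :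
    MeasurePreserving (MeasurableEquiv.piEquivPiSubtypeProd α p) (Measure.pi μ)
      ((Measure.pi fun i : {i // p i} => μ i).prod (Measure.pi fun i : {i // ¬ p i} => μ i)) := by
  convert measurePreserving_piEquivPiSubtypeProd μ p

/-- **A Haar measure on `Π_i H_i ≤ Π_i G_i` with prescribed coordinates**: for inversion-invariant Haar measures `ρ_i` on closed subgroups `H_i`, there is ONE inversion-invariant Haar
measure `ρ` on the subgroup `Subgroup.pi univ H` whose coordinate image (★ `subgroupPiCoords`) is `⊗_i ρ_i` — the `hρ` binder of ★ `map_quotientPiHomeomorph_quotientMeasure_pi`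
(construction as inside ★ `exists_haar_homeomorph_map_quotientMeasure_pi`). [cite: Folland1995, §2.2; §2.6 Thm. 2.49] -/
theorem exists_haar_map_subgroupPiCoords_eq_pi {ι : Type*} [Fintype ι] {G : ι → Type*} [∀ i, Group (G i)] [∀ i, TopologicalSpace (G i)]
    [∀ i, IsTopologicalGroup (G i)] [∀ i, LocallyCompactSpace (G i)] [∀ i, SecondCountableTopology (G i)] [∀ i, MeasurableSpace (G i)] [∀ i, BorelSpace (G i)]
    (H : ∀ i, Subgroup (G i)) (hH : ∀ i, IsClosed (H i : Set (G i)))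
    (ρi : ∀ i, Measure (H i)) [∀ i, (ρi i).IsHaarMeasure] [∀ i, (ρi i).IsInvInvariant] [∀ i, SigmaFinite (ρi i)] :
    ∃ ρ : Measure (Subgroup.pi Set.univ H), ρ.IsHaarMeasure ∧ ρ.IsInvInvariant ∧ Measure.map (subgroupPiCoords H) ρ = Measure.pi ρi := by
  haveI : ∀ i, LocallyCompactSpace (H i) := fun i => (hH i).isClosedEmbedding_subtypeVal.locallyCompactSpace
  have hπc : IsClosed ((Subgroup.pi Set.univ H : Subgroup (∀ i, G i)) : Set (∀ i, G i)) := isClosed_coe_pi H hH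
  haveI : LocallyCompactSpace (Subgroup.pi Set.univ H) := hπc.isClosedEmbedding_subtypeVal.locallyCompactSpace
  let eπ : (Subgroup.pi Set.univ H) ≃ₜ* (∀ i, H i) :=
    { subgroupPiCoords H with
      continuous_toFun := (subgroupPiHomeomorph H).continuous
      continuous_invFun := (subgroupPiHomeomorph H).symm.continuous }
  have heπ : (⇑eπ : (Subgroup.pi Set.univ H) → ∀ i, H i) = subgroupPiCoords H := rfl
  refine ⟨(Measure.pi ρi).map eπ.symm, eπ.symm.isHaarMeasure_map _, isInvInvariant_map_mulEquiv eπ.symm.toMulEquiv eπ.symm.continuous.measurable _, ?_⟩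
  rw [← heπ, Measure.map_map (show Measurable (⇑eπ : (Subgroup.pi Set.univ H) → ∀ i, H i) from eπ.continuous.measurable)
    (show Measurable (⇑eπ.symm : (∀ i, H i) → (Subgroup.pi Set.univ H)) from eπ.symm.continuous.measurable)]
  have : (⇑eπ : (Subgroup.pi Set.univ H) → ∀ i, H i) ∘ ⇑eπ.symm = id := funext fun x => eπ.apply_symm_apply x
  rw [this, Measure.map_id]

end Literature.MeasureTheory.Group

namespace Literature.NumberTheory.Automorphic.UnitaryGroup

/-! ## §0′ The compact-half base point commutes with the product torus -/

section CompactBase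

variable (L : Type) [Field L] [NumberField L] [IsCMField L] (α : Fin 3 → L) (S' : Finset {w : InfinitePlace L // IsComplex w})

/-- The compact-half base point `γ_cpt(c) = (gprimeBlock α w S′ c)_{w∉S′}` commutes with the product torus `Π_{w∉S′} T′_{S′,w}` (the `descConj` binder on `Π_{w∉S′} U(α)_w`;
★ `forall_mem_chartTorusGLoc_comm` coordinate-wise; the instance `ι := {w // w ∉ S′}`, `e := Subtype.val` of (A4)'s family form `forall_mem_pi_chartTorusGLoc_comm` in ★ `ArchOrbFamGSmoothModel`,
spelled `gprimeBlock L α w.1 S′ c` as there). [cite: Rogawski1990, §3.6 p. 31] -/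
theorem forall_mem_piNotMem_chartTorusGLoc_comm (c : {w : InfinitePlace L // IsComplex w} → Fin 3 → ℝ) :
    ∀ m ∈ Subgroup.pi Set.univ (fun w : {w : {w : InfinitePlace L // IsComplex w} // w ∉ S'} => chartTorusGLoc L α w.1 S'),
      m * (fun w : {w : {w : InfinitePlace L // IsComplex w} // w ∉ S'} => gprimeBlock L α w.1 S' c) =
        (fun w : {w : {w : InfinitePlace L // IsComplex w} // w ∉ S'} => gprimeBlock L α w.1 S' c) * m :=
  fun m hm => funext fun w => forall_mem_chartTorusGLoc_comm L α w.1 S' (c w.1) (m w) ((Subgroup.mem_pi _).1 hm w (Set.mem_univ _))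

end CompactBase

/-! ## §1 The all-places product form of `chartOrbG` for an ARBITRARY test function -/

section AllPlaces

variable (L : Type) [Field L] [NumberField L] [IsCMField L] (α : Fin 3 → L) (S' : Finset {w : InfinitePlace L // IsComplex w})
  [∀ w : {w : InfinitePlace L // IsComplex w}, MeasurableSpace ↥(archLocal L 3 (Matrix.diagonal α) w)]
  [∀ w : {w : InfinitePlace L // IsComplex w}, BorelSpace ↥(archLocal L 3 (Matrix.diagonal α) w)]
  -- ★ `locallyCompactSpace_archLocal_three` ∕ ★ `secondCountableTopology_archLocal_three` (theorems, not instances: supplied by the consumer with `haveI`)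
  [∀ w : {w : InfinitePlace L // IsComplex w}, LocallyCompactSpace ↥(archLocal L 3 (Matrix.diagonal α) w)]
  [∀ w : {w : InfinitePlace L // IsComplex w}, SecondCountableTopology ↥(archLocal L 3 (Matrix.diagonal α) w)]
  [MeasurableSpace ↥(arch (↥(maximalRealSubfield L)) L (IsCMField.complexConj L) 3 (Matrix.diagonal α))]
  [BorelSpace ↥(arch (↥(maximalRealSubfield L)) L (IsCMField.complexConj L) 3 (Matrix.diagonal α))]
  [∀ w : {w : InfinitePlace L // IsComplex w}, MeasurableSpace (↥(archLocal L 3 (Matrix.diagonal α) w) ⧸ chartTorusGLoc L α w S')]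
  [∀ w : {w : InfinitePlace L // IsComplex w}, BorelSpace (↥(archLocal L 3 (Matrix.diagonal α) w) ⧸ chartTorusGLoc L α w S')]
  (ν'w : ∀ w : {w : InfinitePlace L // IsComplex w}, Measure ↥(archLocal L 3 (Matrix.diagonal α) w)) [∀ w, (ν'w w).IsHaarMeasure] [∀ w, (ν'w w).IsMulRightInvariant]
  (ν' : Measure ↥(arch (↥(maximalRealSubfield L)) L (IsCMField.complexConj L) 3 (Matrix.diagonal α))) [ν'.IsHaarMeasure] [ν'.IsMulRightInvariant]
  (hν : ν' = (Measure.pi ν'w).map (archPiEquivCM 3 L (Matrix.diagonal α)).symm)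
  (t : ∀ w : {w : InfinitePlace L // IsComplex w}, Measure ↥(chartTorusGLoc L α w S')) [∀ w, (t w).IsHaarMeasure] [∀ w, (t w).IsInvInvariant]

include hν in
/-- **(A1), ALL-PLACES PRODUCT FORM — `chartOrbG` IS ONE INTEGRAL OVER THE PRODUCT OF THE LOCAL QUOTIENTS** (diagonal frame, `hα`, admissible `S′`; product-measure convention
`ν′ = e⁻¹_* ⊗_w ν′_w`; ANY inversion-invariant Haar family `t_w` on the local tori `T′_{S′,w}`): for EVERY test function `a′` and EVERY coordinate `c`,
`chartOrbG L α ν′ S′ a′ c = (Π_w t_w(B′_{S′,w})) · ∫_{Π_w (U(α)_w ⧸ T′_{S′,w})} a′ (e⁻¹ (x_w · γ_w(c) · x_w⁻¹)_w) d(⊗_w (ν′_w ∕ t_w))`, `γ_w(c) = gprimeBlockAt α w S′ (c w)` — a measure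
identity (★ `exists_haar_homeomorph_map_quotientMeasure_pi` + Bochner change of variables along the homeomorphism `Ψ`), no tensor structure, no regularity, no integrability.
[cite: Folland1995, §2.6 Thm. 2.49, (2.52)] [cite: Gelbart1975, p. 155 (10.19)] [cite: Rogawski1990, §8.2 p. 122; §8.3 p. 124] [cite: BorelJacquet1979, §4.1] -/
theorem chartOrbG_eq_prod_mul_integral_pi (hα : ∀ i, α i ≠ 0) (hS' : ∀ w, w ∈ S' → w ∈ splitChartPlaces L α)
    (a' : ↥(arch (↥(maximalRealSubfield L)) L (IsCMField.complexConj L) 3 (Matrix.diagonal α)) → ℂ)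
    (c : {w : InfinitePlace L // IsComplex w} → Fin 3 → ℝ) :
    chartOrbG L α ν' S' a' c =
      (∏ w, ((t w (chartBoxImgGLoc L α w S')).toReal : ℂ)) *
        ∫ x : (∀ w : {w : InfinitePlace L // IsComplex w}, ↥(archLocal L 3 (Matrix.diagonal α) w) ⧸ chartTorusGLoc L α w S'),
          a' ((archPiEquivCM 3 L (Matrix.diagonal α)).symm fun w =>
            descConj (gprimeBlockAt L α w S' (c w)) (chartTorusGLoc L α w S') (forall_mem_chartTorusGLoc_comm L α w S' (c w)) id (x w))
          ∂(Measure.pi fun w => quotientMeasure (chartTorusGLoc L α w S') (t w) (isClosed_chartTorusGLoc L α w S') (ν'w w)) := by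
  letI : MeasurableSpace (↥(arch (↥(maximalRealSubfield L)) L (IsCMField.complexConj L) 3 (Matrix.diagonal α)) ⧸ chartTorusG L α S') := borel _
  haveI : BorelSpace (↥(arch (↥(maximalRealSubfield L)) L (IsCMField.complexConj L) 3 (Matrix.diagonal α)) ⧸ chartTorusG L α S') := ⟨rfl⟩
  haveI : ∀ w, LocallyCompactSpace ↥(chartTorusGLoc L α w S') := fun w => locallyCompactSpace_chartTorusGLoc L α w S'
  haveI : ∀ w, SecondCountableTopology ↥(chartTorusGLoc L α w S') := fun w => TopologicalSpace.Subtype.secondCountableTopology _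
  haveI : ∀ w, SigmaFinite (t w) := fun w => inferInstance
  haveI := locallyCompactSpace_chartTorusG L α S'
  obtain ⟨ρ, hρH, hρI, Ψ, hmass, -, hΨsymm, hmap⟩ := exists_haar_homeomorph_map_quotientMeasure_pi
    (archPiEquivCM 3 L (Matrix.diagonal α)) (fun w => chartTorusGLoc L α w S') (fun w => isClosed_chartTorusGLoc L α w S') (chartTorusG L α S')
    (isClosed_chartTorusG L α S') (mem_chartTorusG_iff_forall_mem_chartTorusGLoc L α S' hα hS') t ν'w ν' hν
  -- the box prefactor
  have hbox : ρ (chartBoxImgG L α S') = ∏ w, t w (chartBoxImgGLoc L α w S') := by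
    rw [chartBoxImgG_eq_setOf_forall_mem_chartBoxImgGLoc L α S' hα hS']
    exact hmass fun w => chartBoxImgGLoc L α w S'
  rw [chartOrbG_eq_of_isHaarMeasure L α S' ν' ρ a' c]
  show ((ρ (chartBoxImgG L α S')).toReal : ℂ) * ∫ y, descConj (gprimeTorus L α S' c) (chartTorusG L α S') (forall_mem_chartTorusG_comm L α S' c) a' y
      ∂(quotientMeasure (chartTorusG L α S') ρ (isClosed_chartTorusG L α S') ν') = _
  rw [hbox, ENNReal.toReal_prod, Complex.ofReal_prod]
  congr 1
  rw [integral_quotientMeasure_eq_integral_pi_of_map_eq' (fun w => chartTorusGLoc L α w S') (fun w => isClosed_chartTorusGLoc L α w S') (chartTorusG L α S')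
    (isClosed_chartTorusG L α S') t ν'w ν' ρ Ψ hmap]
  refine integral_congr_ae (Filter.Eventually.of_forall fun p => ?_)
  exact descConj_homeomorph_symm_eq' (archPiEquivCM 3 L (Matrix.diagonal α)) (fun w => chartTorusGLoc L α w S') (chartTorusG L α S') Ψ hΨsymm
    (fun w => gprimeBlockAt L α w S' (c w)) (fun w => forall_mem_chartTorusGLoc_comm L α w S' (c w)) (forall_mem_chartTorusG_comm L α S' c) a' p

/-! ## §2 The index split `W = {w ∈ S′} ⊔ {w ∉ S′}`: split-chart places × compact-chart places -/

include hν in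
/-- **(A1), SPLIT∕COMPACT PRODUCT FORM** — the all-places integral of §1 read over `(Π_{w∈S′} U(α)_w ⧸ T′_{S′,w}) × (Π_{w∉S′} U(α)_w ⧸ T′_{S′,w})` against the product of the two
product measures (Mathlib `MeasurableEquiv.piEquivPiSubtypeProd`, measure preserving for `Measure.pi`, §0), the integrand READ COORDINATE-WISE (at `w ∈ S′` the split variable
`x.1 ⟨w, _⟩`, at `w ∉ S′` the compact variable `x.2 ⟨w, _⟩`; `Equiv.piEquivPiSubtypeProd_symm_apply`, definitional): for EVERY `a′` and EVERY `c`,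
`chartOrbG ν′ S′ a′ c = (Π_w t_w(B′_w)) · ∫ a′ (e⁻¹ (z_w γ_w(c) z_w⁻¹)_w) d((⊗_{w∈S′} ν′_w∕t_w) ⊗ (⊗_{w∉S′} ν′_w∕t_w))` — still a measure identity, no regularity, no integrability.
[cite: Folland1995, §2.6 (2.52)] [cite: Gelbart1975, p. 155 (10.19)] [cite: Rogawski1990, §8.2 p. 122] -/
theorem chartOrbG_eq_prod_mul_integral_prod_pi (hα : ∀ i, α i ≠ 0) (hS' : ∀ w, w ∈ S' → w ∈ splitChartPlaces L α)
    (a' : ↥(arch (↥(maximalRealSubfield L)) L (IsCMField.complexConj L) 3 (Matrix.diagonal α)) → ℂ)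
    (c : {w : InfinitePlace L // IsComplex w} → Fin 3 → ℝ) :
    chartOrbG L α ν' S' a' c =
      (∏ w, ((t w (chartBoxImgGLoc L α w S')).toReal : ℂ)) *
        ∫ x : (∀ w : {w : {w : InfinitePlace L // IsComplex w} // w ∈ S'}, ↥(archLocal L 3 (Matrix.diagonal α) w.1) ⧸ chartTorusGLoc L α w.1 S') ×
            (∀ w : {w : {w : InfinitePlace L // IsComplex w} // w ∉ S'}, ↥(archLocal L 3 (Matrix.diagonal α) w.1) ⧸ chartTorusGLoc L α w.1 S'),
          a' ((archPiEquivCM 3 L (Matrix.diagonal α)).symm fun w =>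
            descConj (gprimeBlockAt L α w S' (c w)) (chartTorusGLoc L α w S') (forall_mem_chartTorusGLoc_comm L α w S' (c w)) id
              (if h : w ∈ S' then x.1 ⟨w, h⟩ else x.2 ⟨w, h⟩))
          ∂((Measure.pi fun w : {w : {w : InfinitePlace L // IsComplex w} // w ∈ S'} =>
                quotientMeasure (chartTorusGLoc L α w.1 S') (t w.1) (isClosed_chartTorusGLoc L α w.1 S') (ν'w w.1)).prod
            (Measure.pi fun w : {w : {w : InfinitePlace L // IsComplex w} // w ∉ S'} =>
                quotientMeasure (chartTorusGLoc L α w.1 S') (t w.1) (isClosed_chartTorusGLoc L α w.1 S') (ν'w w.1))) := by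
  haveI : ∀ w : {w : InfinitePlace L // IsComplex w}, IsClosed (chartTorusGLoc L α w S' : Set ↥(archLocal L 3 (Matrix.diagonal α) w)) :=
    fun w => isClosed_chartTorusGLoc L α w S'
  haveI : ∀ w : {w : InfinitePlace L // IsComplex w}, SecondCountableTopology (↥(archLocal L 3 (Matrix.diagonal α) w) ⧸ chartTorusGLoc L α w S') := fun w => inferInstance
  haveI : ∀ w : {w : InfinitePlace L // IsComplex w},
      SigmaFinite (quotientMeasure (chartTorusGLoc L α w S') (t w) (isClosed_chartTorusGLoc L α w S') (ν'w w)) := fun w => inferInstance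
  rw [chartOrbG_eq_prod_mul_integral_pi L α S' ν'w ν' hν t hα hS' a' c]
  congr 1
  have h := ((measurePreserving_piEquivPiSubtypeProd'
    (fun w : {w : InfinitePlace L // IsComplex w} => quotientMeasure (chartTorusGLoc L α w S') (t w) (isClosed_chartTorusGLoc L α w S') (ν'w w))
    (fun w => w ∈ S')).symm
    (MeasurableEquiv.piEquivPiSubtypeProd (fun w : {w : InfinitePlace L // IsComplex w} => ↥(archLocal L 3 (Matrix.diagonal α) w) ⧸ chartTorusGLoc L α w S')
      (fun w => w ∈ S'))).integral_comp'
    (fun x : (∀ w : {w : InfinitePlace L // IsComplex w}, ↥(archLocal L 3 (Matrix.diagonal α) w) ⧸ chartTorusGLoc L α w S') =>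
      a' ((archPiEquivCM 3 L (Matrix.diagonal α)).symm fun w =>
        descConj (gprimeBlockAt L α w S' (c w)) (chartTorusGLoc L α w S') (forall_mem_chartTorusGLoc_comm L α w S' (c w)) id (x w)))
  exact h.symm

/-! ## §3 THE MIXED FORM OF RECORD: split half `⊗_{w∈S′} (U_w ⧸ T′_w)`, compact half ONE quotient `(Π_{w∉S′} U_w) ⧸ (Π_{w∉S′} T′_w)` — hypothesis-free -/

include hν in
/-- **(A1), THE MIXED FORM OF RECORD (E3 §4 assembly, F0P3b-p01 (g16) 2026-09-02T10:00:47Z)** — SPLIT HALF AS A PRODUCT OF LOCAL QUOTIENTS, COMPACT HALF AS ONE QUOTIENT,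
HYPOTHESIS-FREE: for admissible `S′`, ANY inversion-invariant Haar family `t_w` on the local tori and ANY inversion-invariant Haar `ρ_cpt` on `M_cpt := Π_{w∉S′} T′_{S′,w} ≤ Π_{w∉S′} U(α)_w`
with coordinates `⊗_{w∉S′} t_w` (`hρ`; supplied by `exists_haar_map_subgroupPiCoords_eq_pi`), EVERY `a′` and EVERY `c`:
`chartOrbG ν′ S′ a′ c = (Π_w t_w(B′_w)) · ∫ a′ (e⁻¹ (w ↦ [w ∈ S′] x_w γ_w(c) x_w⁻¹ ∣ [w ∉ S′] (g γ_cpt(c) g⁻¹)_w)) d((⊗_{w∈S′} ν′_w ∕ t_w) ⊗ ((⊗_{w∉S′} ν′_w) ∕ ρ_cpt))(x, gM_cpt)` —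
the split variables `x_w`, `w ∈ S′`, in `descConj (γ_w(c)) T′_w _ id` currency (what (A2) transports to `U(J₃)(ℂ) ⧸ torusU` and (A3) unfolds to `K_w × N_w`, spectator = the second
factor), the compact variables through ONE `descConj (γ_cpt(c)) M_cpt _` on `Π_{w∉S′} U(α)_w` against a measure finite on compacts (what ★ (HYP-PARAM)∕(A4) differentiates).  §2 + the
measure identity ★ `map_quotientPiHomeomorph_quotientMeasure_pi` on the compact factor (Bochner change of variables along `id × quotientPiHomeomorph`; no Fubini, no integrability).
[cite: Folland1995, §2.6 Thm. 2.49, (2.52)] [cite: Gelbart1975, p. 155 (10.19)] [cite: Rogawski1990, §8.2 p. 122; §8.3 p. 124] [cite: BorelJacquet1979, §4.1] -/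
theorem chartOrbG_eq_prod_mul_integral_pi_prod_quotient (hα : ∀ i, α i ≠ 0) (hS' : ∀ w, w ∈ S' → w ∈ splitChartPlaces L α)
    [MeasurableSpace ((∀ w : {w : {w : InfinitePlace L // IsComplex w} // w ∉ S'}, ↥(archLocal L 3 (Matrix.diagonal α) w.1)) ⧸
      Subgroup.pi Set.univ (fun w : {w : {w : InfinitePlace L // IsComplex w} // w ∉ S'} => chartTorusGLoc L α w.1 S'))]
    [BorelSpace ((∀ w : {w : {w : InfinitePlace L // IsComplex w} // w ∉ S'}, ↥(archLocal L 3 (Matrix.diagonal α) w.1)) ⧸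
      Subgroup.pi Set.univ (fun w : {w : {w : InfinitePlace L // IsComplex w} // w ∉ S'} => chartTorusGLoc L α w.1 S'))]
    (ρcpt : Measure ↥(Subgroup.pi Set.univ (fun w : {w : {w : InfinitePlace L // IsComplex w} // w ∉ S'} => chartTorusGLoc L α w.1 S')))
    [ρcpt.IsHaarMeasure] [ρcpt.IsInvInvariant]
    (hρ : Measure.map (subgroupPiCoords fun w : {w : {w : InfinitePlace L // IsComplex w} // w ∉ S'} => chartTorusGLoc L α w.1 S') ρcpt =
      Measure.pi fun w : {w : {w : InfinitePlace L // IsComplex w} // w ∉ S'} => t w.1)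
    (a' : ↥(arch (↥(maximalRealSubfield L)) L (IsCMField.complexConj L) 3 (Matrix.diagonal α)) → ℂ)
    (c : {w : InfinitePlace L // IsComplex w} → Fin 3 → ℝ) :
    chartOrbG L α ν' S' a' c =
      (∏ w, ((t w (chartBoxImgGLoc L α w S')).toReal : ℂ)) *
        ∫ x : (∀ w : {w : {w : InfinitePlace L // IsComplex w} // w ∈ S'}, ↥(archLocal L 3 (Matrix.diagonal α) w.1) ⧸ chartTorusGLoc L α w.1 S') ×
            ((∀ w : {w : {w : InfinitePlace L // IsComplex w} // w ∉ S'}, ↥(archLocal L 3 (Matrix.diagonal α) w.1)) ⧸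
              Subgroup.pi Set.univ (fun w : {w : {w : InfinitePlace L // IsComplex w} // w ∉ S'} => chartTorusGLoc L α w.1 S')),
          a' ((archPiEquivCM 3 L (Matrix.diagonal α)).symm fun w =>
            if h : w ∈ S' then
              descConj (gprimeBlockAt L α w S' (c w)) (chartTorusGLoc L α w S') (forall_mem_chartTorusGLoc_comm L α w S' (c w)) id (x.1 ⟨w, h⟩)
            else
              descConj (fun w : {w : {w : InfinitePlace L // IsComplex w} // w ∉ S'} => gprimeBlock L α w.1 S' c)
                (Subgroup.pi Set.univ (fun w : {w : {w : InfinitePlace L // IsComplex w} // w ∉ S'} => chartTorusGLoc L α w.1 S'))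
                (forall_mem_piNotMem_chartTorusGLoc_comm L α S' c)
                (fun g => (g ⟨w, h⟩ : ↥(archLocal L 3 (Matrix.diagonal α) w))) x.2)
          ∂((Measure.pi fun w : {w : {w : InfinitePlace L // IsComplex w} // w ∈ S'} =>
                quotientMeasure (chartTorusGLoc L α w.1 S') (t w.1) (isClosed_chartTorusGLoc L α w.1 S') (ν'w w.1)).prod
            (quotientMeasure (Subgroup.pi Set.univ (fun w : {w : {w : InfinitePlace L // IsComplex w} // w ∉ S'} => chartTorusGLoc L α w.1 S')) ρcpt
              (isClosed_coe_pi _ fun w => isClosed_chartTorusGLoc L α w.1 S')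
              (Measure.pi fun w : {w : {w : InfinitePlace L // IsComplex w} // w ∉ S'} => ν'w w.1))) := by
  haveI : ∀ w : {w : InfinitePlace L // IsComplex w}, IsClosed (chartTorusGLoc L α w S' : Set ↥(archLocal L 3 (Matrix.diagonal α) w)) :=
    fun w => isClosed_chartTorusGLoc L α w S'
  haveI : ∀ w : {w : InfinitePlace L // IsComplex w}, SecondCountableTopology (↥(archLocal L 3 (Matrix.diagonal α) w) ⧸ chartTorusGLoc L α w S') := fun w => inferInstance
  haveI : ∀ w : {w : InfinitePlace L // IsComplex w},
      SigmaFinite (quotientMeasure (chartTorusGLoc L α w S') (t w) (isClosed_chartTorusGLoc L α w S') (ν'w w)) := fun w => inferInstance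
  haveI : ∀ w, LocallyCompactSpace ↥(chartTorusGLoc L α w S') := fun w => locallyCompactSpace_chartTorusGLoc L α w S'
  haveI : ∀ w, SecondCountableTopology ↥(chartTorusGLoc L α w S') := fun w => TopologicalSpace.Subtype.secondCountableTopology _
  haveI : ∀ w, SigmaFinite (t w) := fun w => inferInstance
  have hMc : IsClosed ((Subgroup.pi Set.univ (fun w : {w : {w : InfinitePlace L // IsComplex w} // w ∉ S'} => chartTorusGLoc L α w.1 S')) :
      Set (∀ w : {w : {w : InfinitePlace L // IsComplex w} // w ∉ S'}, ↥(archLocal L 3 (Matrix.diagonal α) w.1))) :=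
    isClosed_coe_pi _ fun w => isClosed_chartTorusGLoc L α w.1 S'
  haveI : LocallyCompactSpace ↥(Subgroup.pi Set.univ (fun w : {w : {w : InfinitePlace L // IsComplex w} // w ∉ S'} => chartTorusGLoc L α w.1 S')) :=
    hMc.isClosedEmbedding_subtypeVal.locallyCompactSpace
  haveI : SecondCountableTopology ↥(Subgroup.pi Set.univ (fun w : {w : {w : InfinitePlace L // IsComplex w} // w ∉ S'} => chartTorusGLoc L α w.1 S')) :=
    TopologicalSpace.Subtype.secondCountableTopology _
  haveI : SFinite ρcpt := inferInstance
  rw [chartOrbG_eq_prod_mul_integral_prod_pi L α S' ν'w ν' hν t hα hS' a' c]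
  congr 1
  -- the compact factor: `quotientPiHomeomorph` is measure preserving (★ `map_quotientPiHomeomorph_quotientMeasure_pi`)
  set qπ := quotientPiHomeomorph (fun w : {w : {w : InfinitePlace L // IsComplex w} // w ∉ S'} => chartTorusGLoc L α w.1 S') with hqπ
  have hq : MeasurePreserving qπ.toMeasurableEquiv
      (quotientMeasure (Subgroup.pi Set.univ (fun w : {w : {w : InfinitePlace L // IsComplex w} // w ∉ S'} => chartTorusGLoc L α w.1 S')) ρcpt
        (isClosed_coe_pi _ fun w => isClosed_chartTorusGLoc L α w.1 S') (Measure.pi fun w : {w : {w : InfinitePlace L // IsComplex w} // w ∉ S'} => ν'w w.1))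
      (Measure.pi fun w : {w : {w : InfinitePlace L // IsComplex w} // w ∉ S'} =>
        quotientMeasure (chartTorusGLoc L α w.1 S') (t w.1) (isClosed_chartTorusGLoc L α w.1 S') (ν'w w.1)) :=
    ⟨qπ.toMeasurableEquiv.measurable, by
      rw [Homeomorph.toMeasurableEquiv_coe]
      exact map_quotientPiHomeomorph_quotientMeasure_pi (fun w : {w : {w : InfinitePlace L // IsComplex w} // w ∉ S'} => chartTorusGLoc L α w.1 S')
        (fun w => isClosed_chartTorusGLoc L α w.1 S') (fun w => t w.1) ρcpt hρ (fun w => ν'w w.1)⟩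
  have hE := (MeasurePreserving.id (Measure.pi fun w : {w : {w : InfinitePlace L // IsComplex w} // w ∈ S'} =>
      quotientMeasure (chartTorusGLoc L α w.1 S') (t w.1) (isClosed_chartTorusGLoc L α w.1 S') (ν'w w.1))).prod hq
  have h := (MeasurePreserving.integral_comp' (f := MeasurableEquiv.prodCongr (MeasurableEquiv.refl _) qπ.toMeasurableEquiv) hE
    (fun x : (∀ w : {w : {w : InfinitePlace L // IsComplex w} // w ∈ S'}, ↥(archLocal L 3 (Matrix.diagonal α) w.1) ⧸ chartTorusGLoc L α w.1 S') ×
        (∀ w : {w : {w : InfinitePlace L // IsComplex w} // w ∉ S'}, ↥(archLocal L 3 (Matrix.diagonal α) w.1) ⧸ chartTorusGLoc L α w.1 S') =>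
      a' ((archPiEquivCM 3 L (Matrix.diagonal α)).symm fun w =>
        descConj (gprimeBlockAt L α w S' (c w)) (chartTorusGLoc L α w S') (forall_mem_chartTorusGLoc_comm L α w S' (c w)) id
          (if h : w ∈ S' then x.1 ⟨w, h⟩ else x.2 ⟨w, h⟩))))
  rw [← h]
  refine integral_congr_ae (Filter.Eventually.of_forall fun x => ?_)
  obtain ⟨x₁, x₂⟩ := x
  induction x₂ using QuotientGroup.induction_on with
  | H g =>
    simp only [MeasurableEquiv.prodCongr, MeasurableEquiv.coe_mk, Equiv.prodCongr_apply, Prod.map_apply, hqπ, descConj_mk]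
    congr 2
    funext w
    by_cases h : w ∈ S'
    · rw [dif_pos h, dif_pos h]
      rfl
    · rw [dif_neg h, dif_neg h]
      rfl

/-! ## §4 The ITERATED form: compact-chart places OUTSIDE, split-chart places INSIDE (Fubini) -/

include hν in
/-- **(A1), ITERATED FORM — COMPACT PLACES OUTSIDE, SPLIT PLACES INSIDE** (Fubini on §2): under the `Integrable` binder of the product-coordinates integrand (discharged at every
`c ∈ RegG S′` for `a′ ∈ C_c(G′_∞)` in `chartOrbG_eq_prod_mul_integral_integral_of_regG`),
`chartOrbG ν′ S′ a′ c = (Π_w t_w(B′_w)) · ∫_{Π_{w∉S′}(U_w⧸T′_w)} ( ∫_{Π_{w∈S′}(U_w⧸T′_w)} a′ (e⁻¹ (z_w γ_w(c) z_w⁻¹)_w) d(⊗_{w∈S′}) ) d(⊗_{w∉S′})` (`z_w = x_w` for `w ∈ S′`, `= y_w` for `w ∉ S′`) — the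
split coordinates of `c` and the split variables sit in the INNER integral (what (A2)∕(A3) of the E3 assembly rewrite place by place), the compact ones in the OUTER integral (what ★
(HYP-PARAM) differentiates). [cite: Folland1995, §2.6 (2.52)] [cite: Gelbart1975, p. 155 (10.19)] [cite: Rogawski1990, §8.2 p. 122; §8.3 p. 124] [cite: DeitmarEchterhoff2014, Lemma 9.3.3] -/
theorem chartOrbG_eq_prod_mul_integral_integral (hα : ∀ i, α i ≠ 0) (hS' : ∀ w, w ∈ S' → w ∈ splitChartPlaces L α)
    {a' : ↥(arch (↥(maximalRealSubfield L)) L (IsCMField.complexConj L) 3 (Matrix.diagonal α)) → ℂ}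
    {c : {w : InfinitePlace L // IsComplex w} → Fin 3 → ℝ}
    (hint : Integrable (fun x : (∀ w : {w : InfinitePlace L // IsComplex w}, ↥(archLocal L 3 (Matrix.diagonal α) w) ⧸ chartTorusGLoc L α w S') =>
        a' ((archPiEquivCM 3 L (Matrix.diagonal α)).symm fun w =>
          descConj (gprimeBlockAt L α w S' (c w)) (chartTorusGLoc L α w S') (forall_mem_chartTorusGLoc_comm L α w S' (c w)) id (x w)))
      (Measure.pi fun w => quotientMeasure (chartTorusGLoc L α w S') (t w) (isClosed_chartTorusGLoc L α w S') (ν'w w))) :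
    chartOrbG L α ν' S' a' c =
      (∏ w, ((t w (chartBoxImgGLoc L α w S')).toReal : ℂ)) *
        ∫ y : (∀ w : {w : {w : InfinitePlace L // IsComplex w} // w ∉ S'}, ↥(archLocal L 3 (Matrix.diagonal α) w.1) ⧸ chartTorusGLoc L α w.1 S'),
          (∫ x : (∀ w : {w : {w : InfinitePlace L // IsComplex w} // w ∈ S'}, ↥(archLocal L 3 (Matrix.diagonal α) w.1) ⧸ chartTorusGLoc L α w.1 S'),
            a' ((archPiEquivCM 3 L (Matrix.diagonal α)).symm fun w =>
              descConj (gprimeBlockAt L α w S' (c w)) (chartTorusGLoc L α w S') (forall_mem_chartTorusGLoc_comm L α w S' (c w)) id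
                (if h : w ∈ S' then x ⟨w, h⟩ else y ⟨w, h⟩))
            ∂(Measure.pi fun w : {w : {w : InfinitePlace L // IsComplex w} // w ∈ S'} =>
                quotientMeasure (chartTorusGLoc L α w.1 S') (t w.1) (isClosed_chartTorusGLoc L α w.1 S') (ν'w w.1)))
          ∂(Measure.pi fun w : {w : {w : InfinitePlace L // IsComplex w} // w ∉ S'} =>
                quotientMeasure (chartTorusGLoc L α w.1 S') (t w.1) (isClosed_chartTorusGLoc L α w.1 S') (ν'w w.1)) := by
  haveI : ∀ w : {w : InfinitePlace L // IsComplex w}, IsClosed (chartTorusGLoc L α w S' : Set ↥(archLocal L 3 (Matrix.diagonal α) w)) :=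
    fun w => isClosed_chartTorusGLoc L α w S'
  haveI : ∀ w : {w : InfinitePlace L // IsComplex w}, SecondCountableTopology (↥(archLocal L 3 (Matrix.diagonal α) w) ⧸ chartTorusGLoc L α w S') := fun w => inferInstance
  haveI : ∀ w : {w : InfinitePlace L // IsComplex w},
      SigmaFinite (quotientMeasure (chartTorusGLoc L α w S') (t w) (isClosed_chartTorusGLoc L α w S') (ν'w w)) := fun w => inferInstance
  rw [chartOrbG_eq_prod_mul_integral_prod_pi L α S' ν'w ν' hν t hα hS' a' c]
  congr 1
  -- integrability in the product coordinates (transport of `hint` along the measure-preserving split), then Fubini with the compact factor outside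
  have hmp := (measurePreserving_piEquivPiSubtypeProd'
    (fun w : {w : InfinitePlace L // IsComplex w} => quotientMeasure (chartTorusGLoc L α w S') (t w) (isClosed_chartTorusGLoc L α w S') (ν'w w))
    (fun w => w ∈ S')).symm
    (MeasurableEquiv.piEquivPiSubtypeProd (fun w : {w : InfinitePlace L // IsComplex w} => ↥(archLocal L 3 (Matrix.diagonal α) w) ⧸ chartTorusGLoc L α w S')
      (fun w => w ∈ S'))
  have hint' := (hmp.integrable_comp_emb (MeasurableEquiv.measurableEmbedding _)).2 hint
  exact integral_prod_symm _ hint'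

include hν in
/-- **The `Integrable` binder of §4 at every REGULAR point**: for admissible `S′`, `c ∈ RegG S′` and `a′ ∈ C_c(G′_∞)` the product-coordinates integrand
`x ↦ a′ (e⁻¹ (x_w γ_w(c) x_w⁻¹)_w)` is integrable against `⊗_w (ν′_w ∕ t_w)` — ★ D4b-3 `integrable_descConj_gprimeTorus_of_regG` (the chart is uniformly proper modulo `T_{S′}` at a regular
point) transported along `Ψ` (★ `integrable_quotientMeasure_iff_of_map_eq'`, ★ `descConj_homeomorph_symm_eq'`). [cite: Rogawski1990, §8.3 p. 122] [cite: DeitmarEchterhoff2014, Lemma 9.3.3]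
[cite: Folland1995, §2.6 (2.52)] -/
theorem integrable_comp_symm_archPiEquivCM_descConj_pi_of_regG (hα : ∀ i, α i ≠ 0) (hS' : ∀ w, w ∈ S' → w ∈ splitChartPlaces L α)
    {c : {w : InfinitePlace L // IsComplex w} → Fin 3 → ℝ} (hc : c ∈ ArchCartan.RegG S')
    {a' : ↥(arch (↥(maximalRealSubfield L)) L (IsCMField.complexConj L) 3 (Matrix.diagonal α)) → ℂ} (ha'c : Continuous a') (ha's : HasCompactSupport a') :
    Integrable (fun x : (∀ w : {w : InfinitePlace L // IsComplex w}, ↥(archLocal L 3 (Matrix.diagonal α) w) ⧸ chartTorusGLoc L α w S') =>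
        a' ((archPiEquivCM 3 L (Matrix.diagonal α)).symm fun w =>
          descConj (gprimeBlockAt L α w S' (c w)) (chartTorusGLoc L α w S') (forall_mem_chartTorusGLoc_comm L α w S' (c w)) id (x w)))
      (Measure.pi fun w => quotientMeasure (chartTorusGLoc L α w S') (t w) (isClosed_chartTorusGLoc L α w S') (ν'w w)) := by
  letI : MeasurableSpace (↥(arch (↥(maximalRealSubfield L)) L (IsCMField.complexConj L) 3 (Matrix.diagonal α)) ⧸ chartTorusG L α S') := borel _
  haveI : BorelSpace (↥(arch (↥(maximalRealSubfield L)) L (IsCMField.complexConj L) 3 (Matrix.diagonal α)) ⧸ chartTorusG L α S') := ⟨rfl⟩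
  haveI : ∀ w, LocallyCompactSpace ↥(chartTorusGLoc L α w S') := fun w => locallyCompactSpace_chartTorusGLoc L α w S'
  haveI : ∀ w, SecondCountableTopology ↥(chartTorusGLoc L α w S') := fun w => TopologicalSpace.Subtype.secondCountableTopology _
  haveI : ∀ w, SigmaFinite (t w) := fun w => inferInstance
  haveI := locallyCompactSpace_chartTorusG L α S'
  haveI : IsClosed (chartTorusG L α S' : Set ↥(arch (↥(maximalRealSubfield L)) L (IsCMField.complexConj L) 3 (Matrix.diagonal α))) := isClosed_chartTorusG L α S'
  obtain ⟨ρ, hρH, hρI, Ψ, -, -, hΨsymm, hmap⟩ := exists_haar_homeomorph_map_quotientMeasure_pi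
    (archPiEquivCM 3 L (Matrix.diagonal α)) (fun w => chartTorusGLoc L α w S') (fun w => isClosed_chartTorusGLoc L α w S') (chartTorusG L α S')
    (isClosed_chartTorusG L α S') (mem_chartTorusG_iff_forall_mem_chartTorusGLoc L α S' hα hS') t ν'w ν' hν
  have hI := integrable_descConj_gprimeTorus_of_regG L α S' hα hS' hc ha'c ha's
    (quotientMeasure (chartTorusG L α S') ρ (isClosed_chartTorusG L α S') ν')
  have hI' := (integrable_quotientMeasure_iff_of_map_eq' (fun w => chartTorusGLoc L α w S') (fun w => isClosed_chartTorusGLoc L α w S') (chartTorusG L α S')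
    (isClosed_chartTorusG L α S') t ν'w ν' ρ Ψ hmap _).1 hI
  have hEq : (fun p : (∀ w : {w : InfinitePlace L // IsComplex w}, ↥(archLocal L 3 (Matrix.diagonal α) w) ⧸ chartTorusGLoc L α w S') =>
      descConj (gprimeTorus L α S' c) (chartTorusG L α S') (forall_mem_chartTorusG_comm L α S' c) a' (Ψ.symm p)) =
      fun x => a' ((archPiEquivCM 3 L (Matrix.diagonal α)).symm fun w =>
        descConj (gprimeBlockAt L α w S' (c w)) (chartTorusGLoc L α w S') (forall_mem_chartTorusGLoc_comm L α w S' (c w)) id (x w)) :=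
    funext fun p => descConj_homeomorph_symm_eq' (archPiEquivCM 3 L (Matrix.diagonal α)) (fun w => chartTorusGLoc L α w S') (chartTorusG L α S') Ψ hΨsymm
      (fun w => gprimeBlockAt L α w S' (c w)) (fun w => forall_mem_chartTorusGLoc_comm L α w S' (c w)) (forall_mem_chartTorusG_comm L α S' c) a' p
  rw [hEq] at hI'
  exact hI'

include hν in
/-- **(A1), ITERATED FORM AT A REGULAR POINT, BINDER-FREE**: for admissible `S′`, `c ∈ RegG S′` and `a′ ∈ C_c(G′_∞)`,
`chartOrbG ν′ S′ a′ c = (Π_w t_w(B′_w)) · ∫_{Π_{w∉S′}} ( ∫_{Π_{w∈S′}} a′ (e⁻¹ (z_w γ_w(c) z_w⁻¹)_w) d(⊗_{w∈S′} ν′_w∕t_w) ) d(⊗_{w∉S′} ν′_w∕t_w)` (§4 with its `Integrable` binder discharged by ★ D4b-3).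
[cite: Rogawski1990, §8.2 p. 122; §8.3 pp. 122–124] [cite: Folland1995, §2.6 (2.52)] [cite: Gelbart1975, p. 155 (10.19)] [cite: DeitmarEchterhoff2014, Lemma 9.3.3] -/
theorem chartOrbG_eq_prod_mul_integral_integral_of_regG (hα : ∀ i, α i ≠ 0) (hS' : ∀ w, w ∈ S' → w ∈ splitChartPlaces L α)
    {c : {w : InfinitePlace L // IsComplex w} → Fin 3 → ℝ} (hc : c ∈ ArchCartan.RegG S')
    {a' : ↥(arch (↥(maximalRealSubfield L)) L (IsCMField.complexConj L) 3 (Matrix.diagonal α)) → ℂ} (ha'c : Continuous a') (ha's : HasCompactSupport a') :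
    chartOrbG L α ν' S' a' c =
      (∏ w, ((t w (chartBoxImgGLoc L α w S')).toReal : ℂ)) *
        ∫ y : (∀ w : {w : {w : InfinitePlace L // IsComplex w} // w ∉ S'}, ↥(archLocal L 3 (Matrix.diagonal α) w.1) ⧸ chartTorusGLoc L α w.1 S'),
          (∫ x : (∀ w : {w : {w : InfinitePlace L // IsComplex w} // w ∈ S'}, ↥(archLocal L 3 (Matrix.diagonal α) w.1) ⧸ chartTorusGLoc L α w.1 S'),
            a' ((archPiEquivCM 3 L (Matrix.diagonal α)).symm fun w =>
              descConj (gprimeBlockAt L α w S' (c w)) (chartTorusGLoc L α w S') (forall_mem_chartTorusGLoc_comm L α w S' (c w)) id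
                (if h : w ∈ S' then x ⟨w, h⟩ else y ⟨w, h⟩))
            ∂(Measure.pi fun w : {w : {w : InfinitePlace L // IsComplex w} // w ∈ S'} =>
                quotientMeasure (chartTorusGLoc L α w.1 S') (t w.1) (isClosed_chartTorusGLoc L α w.1 S') (ν'w w.1)))
          ∂(Measure.pi fun w : {w : {w : InfinitePlace L // IsComplex w} // w ∉ S'} =>
                quotientMeasure (chartTorusGLoc L α w.1 S') (t w.1) (isClosed_chartTorusGLoc L α w.1 S') (ν'w w.1)) :=
  chartOrbG_eq_prod_mul_integral_integral L α S' ν'w ν' hν t hα hS'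
    (integrable_comp_symm_archPiEquivCM_descConj_pi_of_regG L α S' ν'w ν' hν t hα hS' hc ha'c ha's)

end AllPlaces

end Literature.NumberTheory.Automorphic.UnitaryGroup

end
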